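import Mathlib
import HarnessLib
import Summits.ABC.ABC.Theses.CongruentialReceptacle
import Summits.ABC.ABC.Theorems.CongruentialReceptacleCompactBalanceTransferSplit
import Summits.ABC.ABC.Theorems.CongruentialReceptacleCompactBalanceTransferPowerDeep

/-!
# Line `birth` — skeleton v2 for the crux `CompactBalanceTransfer` (stmt-ABC-1725)

Route `CongruentialReceptacle` (route-ABC-CongruentialReceptacle), crux `CompactBalanceTransfer := H → ABC`, where
`H := ∀ κ > 0, ∀ ε > 0, ∃ C, ∀ abc-triples, κc ≤ a → κc ≤ b → c < C · rad(abc)^(1+ε)` (abc on every compactly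
balanced cell). v1 (`planner-skel-stmt-ABC-1725-0`, sha 60a683de…, leads c2/c3) carried its composition
infrastructure inline; v2 (lead `prover-line-stmt-ABC-1725-c3-0`, 2026-08-17) imports it from the files landed
under `Theorems/` since, so that the skeleton is exactly: two OPEN stubs + the crux by name + the exactness record.

THE LINE = the crux-strategists' CURRENCY SPLIT D1 with child 2 in POWER-DEEP form D5
(`Cruxes/CompactBalanceTransfer/STRATEGY-CENSUS.md` §4). With
`F := ∀ ε > 0, ∃ C, ∀ abc-triples, (abc)² ≤ C · rad(abc)^(6+ε)` (Szpiro `6+ε` for the Frey curves of ALL triples,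
elementary currency) and `P := ∀ ε > 0, ∃ A, ∀ κ > 0, ∀ κ-balanced abc-triples, c < A·κ^(−1/3)·rad^(1+ε)`:

* `stub_balancedToFreySzpiro : H → F` — child 1; OPEN. Exact shape (landed p139684,
  `Theorems/CongruentialReceptacleCompactBalanceTransferSelfImprovement.lean`): `F ↔ P` and `(H → F) ↔ (H → P)`, i.e.
  the stub says that balanced abc SELF-IMPROVES its constants from arbitrary `C(κ,ε)` to `A_ε·κ^(−1/3)`; crux-hard
  (contains `c < A·rad^(3/2+ε)`-type content on `a = 1`); the only place the line uses `H`, as it must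
  (`Cruxes/CompactBalanceTransfer/Disproof.lean` §2: the crux minus `H` is `ABC`).
* `stub_freySzpiroPowerDeep : F → ∀ δ > 0, abc on {log min(a,b) ≤ (1−δ)·log c}` — child 2 in D5 form; OPEN.
  Exact shape (landed p138328, `Theorems/CongruentialReceptacleCompactBalanceTransferPowerDeep.lean`):
  `freySzpiroToABC_iff_powerDeep : (F → ABC) ↔ stub₂` — Oesterlé's 1988 gap; `F` alone gives exponent `3/2` only
  (`abc_threeHalves_of_freySzpiro`).
* glue `stub_freySzpiroPaysComplement : F → (∀ δ, PowerDeep δ) → ABC` — CLOSED p138328.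
* `CompactBalanceTransfer_of` — the crux BY NAME from the two open stubs via the landed
  `PowerDeep.compactBalanceTransfer_of_stubs`; `crux_iff_stubs` — exactness (`crux ↔ stub₁ ∧ stub₂`), so neither stub
  is refutable short of `¬ABC`; `stubs_of_abc` — both follow from `ABC`.

`sorry` occurs ONLY in the two `stub_*` theorems. Status after lead c3: no stub-level mechanism exists for either
(census S5/S6/N4, re-derived independently in the c3 PICKED.md); recommended outcome promote-stub ×2 = enact D1
(`Cruxes/CompactBalanceTransfer/SPLIT-D1.md`) or the route-level R1.
-/

-- `Summit.<Summit>.<Problem>`: for the single-conjunct summit `ABC` the duplicate `ABC.ABC` is mandated.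
set_option linter.dupNamespace false

namespace Summit.ABC.ABC.Cruxes.CompactBalanceTransfer.Birth

open Literature.NumberTheory.DiophantineGeometry
open Summit.ABC.ABC.Theses.CongruentialReceptacle
open Summit.ABC.ABC.Theorems.CompactBalanceTransfer

-- NOTE: `Summits.ABC.ABC.Theorems.CongruentialReceptacleCompactBalanceTransferSelfImprovement` (p139684, the exact
-- shape of stub 1) is deliberately NOT imported here so that this skeleton elaborates before the farm has built that
-- module; cite `SelfImprovement.balancedToFreySzpiro_iff_selfImprovement` by name.

/-! ## The two registered OPEN stubs -/

/-- **Stub 1 (child 1 of D1, keeps `H`): balanced abc ⟹ Frey–Szpiro for all triples.**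
abc with exponent `1+ε` on every compactly balanced cell `min(a,b) ≥ κc` implies Szpiro `6+ε` in elementary
currency, `(abc)² ≤ C·rad(abc)^(6+ε)`, for ALL abc-triples. Implied by the crux and by `ABC`; converse open.
Exact shape: `SelfImprovement.balancedToFreySzpiro_iff_selfImprovement` (`(H → F) ↔ (H → P)`). Size: crux-hard.
Sources: Oesterle1988, StewartYu2001, Masser1990, MochizukiGenEll2010 (Thm 2.1: bounded degree only). -/
theorem stub_balancedToFreySzpiro :
    (∀ κ : ℝ, 0 < κ → ∀ ε : ℝ, 0 < ε → ∃ C : ℝ, ∀ a b c : ℕ, IsABCTriple a b c →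
        κ * (c : ℝ) ≤ (a : ℝ) → κ * (c : ℝ) ≤ (b : ℝ) →
          (c : ℝ) < C * ((rad a b c : ℕ) : ℝ) ^ (1 + ε)) →
      ∀ ε : ℝ, 0 < ε → ∃ C : ℝ, ∀ a b c : ℕ, IsABCTriple a b c →
        ((a * b * c : ℕ) : ℝ) ^ 2 ≤ C * ((rad a b c : ℕ) : ℝ) ^ (6 + ε) := by
  sorry

/-- **Stub 2 (child 2 of D1 in power-deep form D5, balance-free): Frey–Szpiro ⟹ abc on every power-deep cell.**
Szpiro `6+ε` for the Frey curves of all abc-triples (elementary currency) implies, for every `δ > 0`, abc with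
exponent `1+ε` on the cell `log min(a,b) ≤ (1−δ)·log c`. Equivalent to Oesterlé's implication `F → ABC`
(`PowerDeep.freySzpiroToABC_iff_powerDeep`), hence implied by the crux (p97877) and by `ABC`; open since 1988.
Sources: Oesterle1988, BombieriGubler2006 (Thm 12.5.12), arXiv:2312.03566 (Thm 1.4(1)), MochizukiEtAl2022 (Thm B). -/
theorem stub_freySzpiroPowerDeep :
    (∀ ε : ℝ, 0 < ε → ∃ C : ℝ, ∀ a b c : ℕ, IsABCTriple a b c →
        ((a * b * c : ℕ) : ℝ) ^ 2 ≤ C * ((rad a b c : ℕ) : ℝ) ^ (6 + ε)) →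
      ∀ δ : ℝ, 0 < δ → ∀ ε : ℝ, 0 < ε → ∃ C : ℝ, ∀ a b c : ℕ, IsABCTriple a b c →
        Real.log ((min a b : ℕ) : ℝ) ≤ (1 - δ) * Real.log (c : ℝ) →
          (c : ℝ) < C * ((rad a b c : ℕ) : ℝ) ^ (1 + ε) := by
  sorry

/-! ## The composition: the two stubs prove the crux BY NAME (all glue imported from `Theorems/`) -/

/-- **THE SKELETON THEOREM.** The crux `Summit.ABC.ABC.Theses.CongruentialReceptacle.CompactBalanceTransfer`,
concluded BY NAME from the two declared stubs through the landed glue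
`PowerDeep.compactBalanceTransfer_of_stubs` (p138328: under `H`, stub 1 gives `F`, stub 2 gives abc on every
power-deep cell, and `F` pays for the complement). [folklore] -/
theorem CompactBalanceTransfer_of :
    Summit.ABC.ABC.Theses.CongruentialReceptacle.CompactBalanceTransfer :=
  PowerDeep.compactBalanceTransfer_of_stubs stub_balancedToFreySzpiro stub_freySzpiroPowerDeep

/-! ## Exactness and irrefutability of the stub set (sorry-free) -/

/-- **Exactness.** The crux is EQUIVALENT to the conjunction of the two stub statements (`→`: landed exactness of
D1, `compactBalanceTransfer_iff_subs`, then restriction of `ABC` to the power-deep cells; `←`: the landed glue).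
[folklore] -/
theorem crux_iff_stubs :
    Summit.ABC.ABC.Theses.CongruentialReceptacle.CompactBalanceTransfer ↔
      (((∀ κ : ℝ, 0 < κ → ∀ ε : ℝ, 0 < ε → ∃ C : ℝ, ∀ a b c : ℕ, IsABCTriple a b c →
            κ * (c : ℝ) ≤ (a : ℝ) → κ * (c : ℝ) ≤ (b : ℝ) →
              (c : ℝ) < C * ((rad a b c : ℕ) : ℝ) ^ (1 + ε)) →
          ∀ ε : ℝ, 0 < ε → ∃ C : ℝ, ∀ a b c : ℕ, IsABCTriple a b c →
            ((a * b * c : ℕ) : ℝ) ^ 2 ≤ C * ((rad a b c : ℕ) : ℝ) ^ (6 + ε)) ∧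
        ((∀ ε : ℝ, 0 < ε → ∃ C : ℝ, ∀ a b c : ℕ, IsABCTriple a b c →
            ((a * b * c : ℕ) : ℝ) ^ 2 ≤ C * ((rad a b c : ℕ) : ℝ) ^ (6 + ε)) →
          ∀ δ : ℝ, 0 < δ → ∀ ε : ℝ, 0 < ε → ∃ C : ℝ, ∀ a b c : ℕ, IsABCTriple a b c →
            Real.log ((min a b : ℕ) : ℝ) ≤ (1 - δ) * Real.log (c : ℝ) →
              (c : ℝ) < C * ((rad a b c : ℕ) : ℝ) ^ (1 + ε))) := by
  constructor
  · intro hT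
    obtain ⟨h₁, h₂⟩ := Summit.ABC.ABC.Theorems.compactBalanceTransfer_iff_subs.mp hT
    exact ⟨h₁, fun hF => PowerDeep.powerDeep_of_abc (h₂ hF)⟩
  · rintro ⟨h₁, h₂⟩
    exact PowerDeep.compactBalanceTransfer_of_stubs h₁ h₂

/-- Both stubs are implied by `ABC` (so neither can be refuted short of `¬ABC`). [folklore] -/
theorem stubs_of_abc (h : _root_.ABC) :
    ((∀ κ : ℝ, 0 < κ → ∀ ε : ℝ, 0 < ε → ∃ C : ℝ, ∀ a b c : ℕ, IsABCTriple a b c →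
          κ * (c : ℝ) ≤ (a : ℝ) → κ * (c : ℝ) ≤ (b : ℝ) →
            (c : ℝ) < C * ((rad a b c : ℕ) : ℝ) ^ (1 + ε)) →
        ∀ ε : ℝ, 0 < ε → ∃ C : ℝ, ∀ a b c : ℕ, IsABCTriple a b c →
          ((a * b * c : ℕ) : ℝ) ^ 2 ≤ C * ((rad a b c : ℕ) : ℝ) ^ (6 + ε)) ∧
      ((∀ ε : ℝ, 0 < ε → ∃ C : ℝ, ∀ a b c : ℕ, IsABCTriple a b c →
          ((a * b * c : ℕ) : ℝ) ^ 2 ≤ C * ((rad a b c : ℕ) : ℝ) ^ (6 + ε)) →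
        ∀ δ : ℝ, 0 < δ → ∀ ε : ℝ, 0 < ε → ∃ C : ℝ, ∀ a b c : ℕ, IsABCTriple a b c →
          Real.log ((min a b : ℕ) : ℝ) ≤ (1 - δ) * Real.log (c : ℝ) →
            (c : ℝ) < C * ((rad a b c : ℕ) : ℝ) ^ (1 + ε)) :=
  ⟨fun _ => Summit.ABC.ABC.Theorems.freySzpiroAll_of_abc h, fun _ => PowerDeep.powerDeep_of_abc h⟩

end Summit.ABC.ABC.Cruxes.CompactBalanceTransfer.Birth
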